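import Summits.AtomisticToContinuum.FouriersLaw.Theorems.OddSectorIrreversibilityWitnessGlueKernels

/-!
# `TapLeakBound` (stmt-AtomisticToContinuum-15159), line `Sketch` — stub 4: resampling preserves `μ_T ⊗ N(0,T)`

Support file for the crux `OddSectorIrreversibility.TapLeakBound` (route OddSectorIrreversibility of
`AtomisticToContinuum/FouriersLaw`), skeleton line `Sketch`. Fixed-`N` Gibbs calculus, sorry-free:

the resampling involution `S(x, t) = ((q, p[b ↦ t]), p_b)` of `PhaseSpace N × ℝ`, which swaps the contact
momentum `p_b` with an independent `N(0,T)` sample `t`, preserves the product `ν = μ_T ⊗ N(0,T)` of the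
(unnormalised) Gibbs weight `μ_T = e^{-H_N/T} dq dp` with the centred Gaussian of variance `T`.

Proof: for `T > 0` both factors have Lebesgue densities, so `ν = (dq dp dt) · D` with
`D(x,t) = e^{-H(x)/T} φ_T(t)`; the kinetic identity `H(q, p[b ↦ t]) + p_b²/2 = H(q,p) + t²/2` gives
`D ∘ S = D`, and `S` is a permutation of Lebesgue coordinates (conjugate, through
`MeasurableEquiv.piFinSuccAbove`, to `((r, p♭), t) ↦ ((t, p♭), r)`), hence Lebesgue-measure preserving.

No statement of the route is asserted here.
-/

noncomputable section

open MeasureTheory ProbabilityTheory Filter Topology Set Function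
open scoped NNReal ENNReal

namespace Summit.AtomisticToContinuum.FouriersLaw.Theorems.OddSectorIrreversibility.TapLeak

open Literature.MathematicalPhysics.KineticTheory.HeatConduction
open Summit.AtomisticToContinuum.FouriersLaw.Theorems.OddSectorWitness

/-! ## Weighted measures under density-preserving maps -/

/-- A measure-preserving self-map that leaves a measurable density invariant preserves the weighted
measure. [folklore] -/
theorem measurePreserving_withDensity_of_invariant {α : Type*} [MeasurableSpace α] {S : α → α}
    {μ : Measure α} (h : MeasurePreserving S μ μ) {D : α → ℝ≥0∞} (hD : Measurable D)
    (hinv : ∀ x, D (S x) = D x) :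
    MeasurePreserving S (μ.withDensity D) (μ.withDensity D) := by
  -- adapted from Literature/MathematicalPhysics/KineticTheory/InfiniteChainSeveredGibbs.lean
  -- (`MeasurePreserving.withDensity_of_comp_eq`, not imported here)
  refine ⟨h.measurable, Measure.ext fun s hs => ?_⟩
  rw [Measure.map_apply h.measurable hs, withDensity_apply _ (hs.preimage h.measurable),
    withDensity_apply _ hs]
  calc ∫⁻ x in S ⁻¹' s, D x ∂μ = ∫⁻ x in S ⁻¹' s, D (S x) ∂μ := by simp_rw [hinv]
    _ = ∫⁻ x in s, D x ∂μ := h.setLIntegral_comp_preimage hs hD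

/-! ## The resampling map preserves Lebesgue measure -/

/-- The coordinate exchange `((r, g), t) ↦ ((t, g), r)` preserves the triple product of Lebesgue
measures on `(ℝ × (Fin n → ℝ)) × ℝ`. [folklore] -/
theorem measurePreserving_exchange (n : ℕ) :
    MeasurePreserving (fun w : (ℝ × (Fin n → ℝ)) × ℝ => ((w.2, w.1.2), w.1.1))
      (((volume : Measure ℝ).prod (volume : Measure (Fin n → ℝ))).prod (volume : Measure ℝ))
      (((volume : Measure ℝ).prod (volume : Measure (Fin n → ℝ))).prod (volume : Measure ℝ)) := by
  have h1 : MeasurePreserving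
      (MeasurableEquiv.prodAssoc : (ℝ × (Fin n → ℝ)) × ℝ ≃ᵐ ℝ × (Fin n → ℝ) × ℝ)
      (((volume : Measure ℝ).prod (volume : Measure (Fin n → ℝ))).prod (volume : Measure ℝ))
      ((volume : Measure ℝ).prod ((volume : Measure (Fin n → ℝ)).prod (volume : Measure ℝ))) :=
    measurePreserving_prodAssoc volume volume volume
  have h2 : MeasurePreserving (Prod.swap : ℝ × ((Fin n → ℝ) × ℝ) → ((Fin n → ℝ) × ℝ) × ℝ)
      ((volume : Measure ℝ).prod ((volume : Measure (Fin n → ℝ)).prod (volume : Measure ℝ)))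
      (((volume : Measure (Fin n → ℝ)).prod (volume : Measure ℝ)).prod (volume : Measure ℝ)) :=
    Measure.measurePreserving_swap
  have h3 : MeasurePreserving (Prod.swap : (Fin n → ℝ) × ℝ → ℝ × (Fin n → ℝ))
      ((volume : Measure (Fin n → ℝ)).prod (volume : Measure ℝ))
      ((volume : Measure ℝ).prod (volume : Measure (Fin n → ℝ))) :=
    Measure.measurePreserving_swap
  have h4 := (h3.prod (MeasurePreserving.id (volume : Measure ℝ))).comp (h2.comp h1)
  exact h4

/-- Swapping the `b`-th coordinate with the extra one, `(p, t) ↦ (p[b ↦ t], p_b)`, preserves Lebesgue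
measure on `(Fin N → ℝ) × ℝ` (conjugate to `measurePreserving_exchange` through
`MeasurableEquiv.piFinSuccAbove … b`). [folklore] -/
theorem measurePreserving_updateSwap {N : ℕ} (b : Fin N) :
    MeasurePreserving (fun w : (Fin N → ℝ) × ℝ => (Function.update w.1 b w.2, w.1 b))
      ((volume : Measure (Fin N → ℝ)).prod (volume : Measure ℝ))
      ((volume : Measure (Fin N → ℝ)).prod (volume : Measure ℝ)) := by
  obtain ⟨n, rfl⟩ : ∃ n, N = n + 1 := ⟨N - 1, by have := b.pos; omega⟩
  set e := MeasurableEquiv.piFinSuccAbove (fun _ : Fin (n + 1) => ℝ) b with he_def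
  have he : MeasurePreserving e (volume : Measure (Fin (n + 1) → ℝ))
      ((volume : Measure ℝ).prod (volume : Measure (Fin n → ℝ))) :=
    volume_preserving_piFinSuccAbove (fun _ => ℝ) b
  have h := ((he.symm.prod (MeasurePreserving.id (volume : Measure ℝ))).comp
    (measurePreserving_exchange n)).comp (he.prod (MeasurePreserving.id (volume : Measure ℝ)))
  convert h using 1
  funext w
  simp only [Function.comp_apply, Prod.map, id, he_def, MeasurableEquiv.piFinSuccAbove_symm_apply,
    MeasurableEquiv.piFinSuccAbove_apply, Fin.insertNthEquiv, Equiv.coe_fn_mk, Equiv.coe_fn_symm_mk,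
    Fin.insertNth_removeNth]

/-- The resampling involution `S(x, t) = ((q, p[b ↦ t]), p_b)` preserves Lebesgue measure on
`PhaseSpace N × ℝ`. [folklore] -/
theorem measurePreserving_resample_volume {N : ℕ} (b : Fin N) :
    MeasurePreserving
      (fun z : PhaseSpace N × ℝ => ((((z.1.1, Function.update z.1.2 b z.2)) : PhaseSpace N), z.1.2 b))
      ((volume : Measure (PhaseSpace N)).prod (volume : Measure ℝ))
      ((volume : Measure (PhaseSpace N)).prod (volume : Measure ℝ)) := by
  have hA : MeasurePreserving
      (MeasurableEquiv.prodAssoc : ((Fin N → ℝ) × (Fin N → ℝ)) × ℝ ≃ᵐ (Fin N → ℝ) × (Fin N → ℝ) × ℝ)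
      ((volume : Measure (PhaseSpace N)).prod (volume : Measure ℝ))
      ((volume : Measure (Fin N → ℝ)).prod ((volume : Measure (Fin N → ℝ)).prod (volume : Measure ℝ))) :=
    measurePreserving_prodAssoc volume volume volume
  have h := hA.symm.comp
    (((MeasurePreserving.id (volume : Measure (Fin N → ℝ))).prod (measurePreserving_updateSwap b)).comp hA)
  exact h

/-! ## The density is invariant -/

/-- Resampling one momentum changes the Hamiltonian only through its kinetic term:
`H(q, p[b ↦ t]) + p_b²/2 = H(q, p) + t²/2`. [folklore] -/
theorem hamiltonian_update_momentum (P : OscillatorChain) {N : ℕ} (b : Fin N) (q p : Fin N → ℝ) (t : ℝ) :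
    P.hamiltonian N (q, Function.update p b t) + p b ^ 2 / 2 = P.hamiltonian N (q, p) + t ^ 2 / 2 := by
  obtain ⟨n, rfl⟩ : ∃ n, N = n + 1 := ⟨N - 1, by have := b.pos; omega⟩
  simp only [OscillatorChain.hamiltonian, Finset.sum_add_distrib]
  rw [Fin.sum_univ_succAbove (fun i => Function.update p b t i ^ 2 / 2) b,
    Fin.sum_univ_succAbove (fun i => p i ^ 2 / 2) b]
  simp only [Function.update_self, Function.update_of_ne (Fin.succAbove_ne b _)]
  ring

/-! ## The stub -/

/-- STUB 4 of line `Sketch` (fixed `N`): the resampling involution `S(x, t) = ((q, p[b ↦ t]), p_b)` of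
`PhaseSpace N × ℝ` (swap the contact momentum with the independent Gaussian sample) preserves the product
of the Gibbs weight `μ_T = e^{-H_N/T} dq dp` with `N(0,T)`: the joint Lebesgue density
`e^{-H(x)/T} φ_T(t)` is `S`-invariant (`H = p_b²/2 + (terms without p_b)`), and `S` permutes Lebesgue
coordinates. [folklore] -/
theorem stub_resamplePreserving : ∀ (ω₂ lam β γ : ℝ) {T : ℝ}, 0 < T → ∀ {N : ℕ} (b : Fin N),
    MeasurePreserving
      (fun z : PhaseSpace N × ℝ => ((((z.1.1, Function.update z.1.2 b z.2)) : PhaseSpace N), z.1.2 b))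
      ((gibbsWeight ω₂ lam β γ N T).prod (gaussianReal 0 (Real.toNNReal T)))
      ((gibbsWeight ω₂ lam β γ N T).prod (gaussianReal 0 (Real.toNNReal T))) := by
  intro ω₂ lam β γ T hT N b
  have hv : T.toNNReal ≠ 0 := (Real.toNNReal_pos.2 hT).ne'
  have hvT : ((T.toNNReal : ℝ≥0) : ℝ) = T := Real.coe_toNNReal T hT.le
  rw [gaussianReal_of_var_ne_zero 0 hv]
  unfold gibbsWeight
  rw [prod_withDensity (measurable_gibbsDensity_ofReal γ N T) (measurable_gaussianPDF 0 _)]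
  have hD : Measurable fun z : PhaseSpace N × ℝ =>
      ENNReal.ofReal (Real.exp (-((pinnedChain ω₂ lam β γ).hamiltonian N z.1) / T)) *
        gaussianPDF 0 T.toNNReal z.2 := by
    have h := ((measurable_gibbsDensity_ofReal (ω₂ := ω₂) (lam := lam) (β := β) γ N T).comp
      measurable_fst).mul ((measurable_gaussianPDF 0 T.toNNReal).comp measurable_snd)
    exact h
  refine measurePreserving_withDensity_of_invariant (measurePreserving_resample_volume b) hD ?_
  rintro ⟨⟨q, p⟩, t⟩
  simp only [gaussianPDF, gaussianPDFReal, hvT, sub_zero]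
  rw [← ENNReal.ofReal_mul (Real.exp_pos _).le, ← ENNReal.ofReal_mul (Real.exp_pos _).le]
  congr 1
  set P := pinnedChain ω₂ lam β γ
  have hH : P.hamiltonian N (q, Function.update p b t) = P.hamiltonian N (q, p) + t ^ 2 / 2 - p b ^ 2 / 2 := by
    have h := hamiltonian_update_momentum P b q p t
    linarith
  have key : -P.hamiltonian N (q, Function.update p b t) / T + -(p b) ^ 2 / (2 * T) =
      -P.hamiltonian N (q, p) / T + -t ^ 2 / (2 * T) := by
    rw [hH]
    ring
  calc Real.exp (-P.hamiltonian N (q, Function.update p b t) / T) *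
        ((Real.sqrt (2 * Real.pi * T))⁻¹ * Real.exp (-(p b) ^ 2 / (2 * T)))
      = (Real.sqrt (2 * Real.pi * T))⁻¹ *
          Real.exp (-P.hamiltonian N (q, Function.update p b t) / T + -(p b) ^ 2 / (2 * T)) := by
        rw [Real.exp_add]; ring
    _ = (Real.sqrt (2 * Real.pi * T))⁻¹ * Real.exp (-P.hamiltonian N (q, p) / T + -t ^ 2 / (2 * T)) := by
        rw [key]
    _ = Real.exp (-P.hamiltonian N (q, p) / T) *
          ((Real.sqrt (2 * Real.pi * T))⁻¹ * Real.exp (-t ^ 2 / (2 * T))) := by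
        rw [Real.exp_add]; ring

end Summit.AtomisticToContinuum.FouriersLaw.Theorems.OddSectorIrreversibility.TapLeak

end
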